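import Mathlib.Analysis.SpecialFunctions.Log.Deriv
import Mathlib.Analysis.SpecialFunctions.Pow.Real
import Mathlib.Analysis.Convex.Deriv
import Mathlib.Analysis.Calculus.Deriv.MeanValue
import HarnessLib

/-!
# Concavity lemmas behind the convexity of Hamilton's pinching sets (Hamilton 1997, §2)
(topic `Geometry/Riemannian`)

Real-analysis support for `PinchingSetsConvexity.lean` (decomposition of
`Literature.Geometry.Riemannian.hamilton_chenZhu_pinching`): Hamilton's maximum principle needs
the pinching sets to be *convex*, and Hamilton proves this (1997, p. 8: "the set `y² ≤ Λxz` is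
convex"; pp. 13–14, proof of Thm. 2.1: "`x = √((a₁+a₂)(c₁+c₂))` is concave, while `y = 2b₃` is
convex. Then if `y = f(x)` is a concave increasing function, the set `y ≤ f(x)` will be convex
… `y'' ≤ 0` in either case … at `x = e²` the derivative from the left is greater than the
derivative from the right, so there is no problem with concavity there"; p. 17: "The inequality
defines a convex set for the same reason as before if `Q ≥ 2`"). We prove the two-point
(chord) inequalities that the variational sets need:

* `geomMean_combo_sq_le`, `sq_combo_le`, `sqrt_combo_le` — concavity of the geometric mean
  `√(xz)` on the quadrant and convexity of `{y² ≤ Λxz}`, `{y ≤ c√(xz)}` there (Thms. 1.3, 1.9).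
* `concaveOn_logBarrier`, `monotoneOn_logBarrier`, `logBarrier_combo_le` — Hamilton's function
  `F(u) = (1 + K/max{ln u, Q}) u` is concave and non-decreasing on `[0, ∞)` for `K ≥ 0`, `Q ≥ 2`
  (via `u/max{ln u, Q} = min (u/Q, tlog u)` with `tlog` the `C¹` concave extension of `u/ln u`
  from `[e², ∞)` by its tangent line at `e²` — this is where `Q ≥ 2` enters, exactly as in the
  printed proof), whence the chord inequality for the sets of Thms. 2.1 and 2.3.

## References

* R. S. Hamilton, *Four-manifolds with positive isotropic curvature*, Comm. Anal. Geom. 5 (1997)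
  1–92, §2.1 p. 8, §2.2 pp. 13–14 and p. 17 (convexity of the pinching sets). [Hamilton1997]
-/

noncomputable section

open Set Real Filter Topology

namespace Literature.Geometry.Riemannian

namespace HamiltonODE

/-! ### Concave combinations under `y² ≤ Λ x z` and `y ≤ c √(xz)` -/

/-- **The geometric mean is concave on the quadrant**, squared chord form: for `a, b, xᵢ, zᵢ ≥ 0`,
`(a√(x₁z₁) + b√(x₂z₂))² ≤ (ax₁ + bx₂)(az₁ + bz₂)` (the difference is `ab(√(x₁z₂) - √(x₂z₁))²`).
[folklore] -/
theorem geomMean_combo_sq_le {a b x₁ x₂ z₁ z₂ : ℝ} (ha : 0 ≤ a) (hb : 0 ≤ b) (hx₁ : 0 ≤ x₁)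
    (hx₂ : 0 ≤ x₂) (hz₁ : 0 ≤ z₁) (hz₂ : 0 ≤ z₂) :
    (a * sqrt (x₁ * z₁) + b * sqrt (x₂ * z₂)) ^ 2 ≤ (a * x₁ + b * x₂) * (a * z₁ + b * z₂) := by
  set p := sqrt (x₁ * z₂)
  set q := sqrt (x₂ * z₁)
  have hp : p ^ 2 = x₁ * z₂ := Real.sq_sqrt (mul_nonneg hx₁ hz₂)
  have hq : q ^ 2 = x₂ * z₁ := Real.sq_sqrt (mul_nonneg hx₂ hz₁)
  have h1 : sqrt (x₁ * z₁) ^ 2 = x₁ * z₁ := Real.sq_sqrt (mul_nonneg hx₁ hz₁)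
  have h2 : sqrt (x₂ * z₂) ^ 2 = x₂ * z₂ := Real.sq_sqrt (mul_nonneg hx₂ hz₂)
  have h12 : sqrt (x₁ * z₁) * sqrt (x₂ * z₂) = p * q := by
    rw [← Real.sqrt_mul (mul_nonneg hx₁ hz₁), ← Real.sqrt_mul (mul_nonneg hx₁ hz₂)]
    congr 1; ring
  have eL : (a * sqrt (x₁ * z₁) + b * sqrt (x₂ * z₂)) ^ 2 =
      a ^ 2 * sqrt (x₁ * z₁) ^ 2 + 2 * a * b * (sqrt (x₁ * z₁) * sqrt (x₂ * z₂)) +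
        b ^ 2 * sqrt (x₂ * z₂) ^ 2 := by ring
  have eR : (a * x₁ + b * x₂) * (a * z₁ + b * z₂) =
      a ^ 2 * (x₁ * z₁) + a * b * (x₁ * z₂) + a * b * (x₂ * z₁) + b ^ 2 * (x₂ * z₂) := by ring
  rw [eL, eR, h1, h2, h12, ← hp, ← hq]
  nlinarith [mul_nonneg (mul_nonneg ha hb) (sq_nonneg (p - q))]

/-- Chord inequality of the geometric mean: `a√(x₁z₁) + b√(x₂z₂) ≤ √((ax₁+bx₂)(az₁+bz₂))`.
[folklore] -/
theorem geomMean_combo_le_sqrt {a b x₁ x₂ z₁ z₂ : ℝ} (ha : 0 ≤ a) (hb : 0 ≤ b) (hx₁ : 0 ≤ x₁)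
    (hx₂ : 0 ≤ x₂) (hz₁ : 0 ≤ z₁) (hz₂ : 0 ≤ z₂) :
    a * sqrt (x₁ * z₁) + b * sqrt (x₂ * z₂) ≤ sqrt ((a * x₁ + b * x₂) * (a * z₁ + b * z₂)) :=
  Real.le_sqrt_of_sq_le (geomMean_combo_sq_le ha hb hx₁ hx₂ hz₁ hz₂)

/-- **`{y² ≤ Λxz, x ≥ 0, z ≥ 0}` is convex** (Hamilton 1997, p. 8: "the set `y² ≤ Λxz` is convex
for any `Λ`"), chord form. [cite: Hamilton1997, §2.1, Thm. 1.3 (proof, p. 8)] -/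
theorem sq_combo_le {a b Λ y₁ y₂ x₁ x₂ z₁ z₂ : ℝ} (ha : 0 ≤ a) (hb : 0 ≤ b) (hΛ : 0 ≤ Λ)
    (hx₁ : 0 ≤ x₁) (hx₂ : 0 ≤ x₂) (hz₁ : 0 ≤ z₁) (hz₂ : 0 ≤ z₂)
    (h₁ : y₁ ^ 2 ≤ Λ * x₁ * z₁) (h₂ : y₂ ^ 2 ≤ Λ * x₂ * z₂) :
    (a * y₁ + b * y₂) ^ 2 ≤ Λ * (a * x₁ + b * x₂) * (a * z₁ + b * z₂) := by
  have hy : |y₁ * y₂| ≤ Λ * (x₁ * z₂ + x₂ * z₁) / 2 := by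
    refine abs_le_of_sq_le_sq ?_ (by positivity)
    calc (y₁ * y₂) ^ 2 = y₁ ^ 2 * y₂ ^ 2 := by ring
      _ ≤ (Λ * x₁ * z₁) * (Λ * x₂ * z₂) :=
          mul_le_mul h₁ h₂ (sq_nonneg _) (by positivity)
      _ ≤ (Λ * (x₁ * z₂ + x₂ * z₁) / 2) ^ 2 := by
          nlinarith [sq_nonneg (x₁ * z₂ - x₂ * z₁), sq_nonneg Λ,
            mul_nonneg (sq_nonneg Λ) (sq_nonneg (x₁ * z₂ - x₂ * z₁))]
  have hy' : y₁ * y₂ ≤ Λ * (x₁ * z₂ + x₂ * z₁) / 2 := (le_abs_self _).trans hy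
  have k₁ : a ^ 2 * y₁ ^ 2 ≤ a ^ 2 * (Λ * x₁ * z₁) := mul_le_mul_of_nonneg_left h₁ (sq_nonneg a)
  have k₂ : b ^ 2 * y₂ ^ 2 ≤ b ^ 2 * (Λ * x₂ * z₂) := mul_le_mul_of_nonneg_left h₂ (sq_nonneg b)
  have k₃ : 2 * a * b * (y₁ * y₂) ≤ 2 * a * b * (Λ * (x₁ * z₂ + x₂ * z₁) / 2) :=
    mul_le_mul_of_nonneg_left hy' (by positivity)
  nlinarith [k₁, k₂, k₃]

/-- **`{y ≤ c√(xz), x ≥ 0, z ≥ 0}` is convex** for `c ≥ 0` (the set of Hamilton 1997, Thm. 1.9),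
chord form. [cite: Hamilton1997, §2.1, Thm. 1.9 (p. 12)] -/
theorem sqrt_combo_le {a b c y₁ y₂ x₁ x₂ z₁ z₂ : ℝ} (ha : 0 ≤ a) (hb : 0 ≤ b) (hc : 0 ≤ c)
    (hx₁ : 0 ≤ x₁) (hx₂ : 0 ≤ x₂) (hz₁ : 0 ≤ z₁) (hz₂ : 0 ≤ z₂)
    (h₁ : y₁ ≤ c * sqrt (x₁ * z₁)) (h₂ : y₂ ≤ c * sqrt (x₂ * z₂)) :
    a * y₁ + b * y₂ ≤ c * sqrt ((a * x₁ + b * x₂) * (a * z₁ + b * z₂)) := by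
  calc a * y₁ + b * y₂ ≤ a * (c * sqrt (x₁ * z₁)) + b * (c * sqrt (x₂ * z₂)) := by gcongr
    _ = c * (a * sqrt (x₁ * z₁) + b * sqrt (x₂ * z₂)) := by ring
    _ ≤ c * sqrt ((a * x₁ + b * x₂) * (a * z₁ + b * z₂)) :=
        mul_le_mul_of_nonneg_left (geomMean_combo_le_sqrt ha hb hx₁ hx₂ hz₁ hz₂) hc

/-! ### The function `u ↦ u / max{ln u, Q}` is concave and monotone on `[0, ∞)` for `Q ≥ 2` -/

/-- The `C¹` extension of `u / ln u` from `[e², ∞)` by its tangent line at `e²` (slope `¼`, value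
`e²/2`): `u/4 + e²/4` for `u ≤ e²`, `u/ln u` beyond (Hamilton 1997, p. 14: the two branches of
`f` meet at `x = e²` with matching concavity). [cite: Hamilton1997, §2.2, Thm. 2.1 (proof, p. 14)] -/
def tlog (s : ℝ) : ℝ := if s ≤ exp 2 then s / 4 + exp 2 / 4 else s / log s

/-- The derivative of `tlog`: `¼` for `u ≤ e²`, `(ln u - 1)/ln² u` beyond. [cite: Hamilton1997, §2.2, Thm. 2.1 (proof, p. 14)] -/
def tlog' (s : ℝ) : ℝ := if s ≤ exp 2 then 1 / 4 else (log s - 1) / log s ^ 2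

/-- `(u / ln u)' = (ln u - 1)/ln² u` for `u > 1`. [folklore] -/
theorem hasDerivAt_div_log {s : ℝ} (hs : 1 < s) :
    HasDerivAt (fun x : ℝ ↦ x / log x) ((log s - 1) / log s ^ 2) s := by
  have hs0 : s ≠ 0 := by positivity
  have hlog : log s ≠ 0 := (Real.log_pos hs).ne'
  have h := (hasDerivAt_id s).div (Real.hasDerivAt_log hs0) hlog
  have e : (1 * log s - id s * s⁻¹) / log s ^ 2 = (log s - 1) / log s ^ 2 := by
    simp only [id, one_mul, mul_inv_cancel₀ hs0]
  exact h.congr_deriv e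

/-- `u > e²` gives `ln u > 2`. [folklore] -/
theorem two_lt_log {s : ℝ} (hs : exp 2 < s) : 2 < log s := by
  rwa [lt_log_iff_exp_lt ((exp_pos 2).trans hs)]

/-- On `[e², ∞)`, `tlog u = u / ln u` (the branches agree at `e²`). [folklore] -/
theorem tlog_of_ge {s : ℝ} (hs : exp 2 ≤ s) : tlog s = s / log s := by
  unfold tlog
  split_ifs with h
  · have : s = exp 2 := le_antisymm h hs
    subst this
    rw [log_exp]; ring
  · rfl

/-- `tlog` is differentiable everywhere with derivative `tlog'` (at the junction `e²` the
one-sided derivatives are both `¼`). [cite: Hamilton1997, §2.2, Thm. 2.1 (proof, p. 14)] -/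
theorem hasDerivAt_tlog (s : ℝ) : HasDerivAt tlog (tlog' s) s := by
  rcases lt_trichotomy s (exp 2) with hs | rfl | hs
  · have hev : tlog =ᶠ[𝓝 s] fun x ↦ x / 4 + exp 2 / 4 :=
      (eventually_lt_nhds hs).mono fun x hx ↦ by simp [tlog, hx.le]
    rw [hev.hasDerivAt_iff]
    simp only [tlog', hs.le, if_true]
    simpa using ((hasDerivAt_id s).div_const 4).add_const (exp 2 / 4)
  · -- at the junction: one-sided derivatives agree
    have hval : tlog' (exp 2) = 1 / 4 := by simp [tlog']
    rw [hval]
    have hl : HasDerivWithinAt tlog (1 / 4) (Iic (exp 2)) (exp 2) := by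
      have h := (((hasDerivAt_id (exp 2)).div_const 4).add_const (exp 2 / 4)).hasDerivWithinAt
        (s := Iic (exp 2))
      simp only [one_div] at h ⊢
      refine (h.congr (fun x hx ↦ ?_) ?_)
      · simp [tlog, (mem_Iic.1 hx)]
      · simp [tlog]
    have hr : HasDerivWithinAt tlog (1 / 4) (Ici (exp 2)) (exp 2) := by
      have h := (hasDerivAt_div_log (s := exp 2) (by have := add_one_le_exp (2:ℝ); linarith))
      rw [log_exp] at h
      have h' := h.hasDerivWithinAt (s := Ici (exp 2))
      have e : ((2 : ℝ) - 1) / 2 ^ 2 = 1 / 4 := by norm_num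
      rw [e] at h'
      refine h'.congr (fun x hx ↦ tlog_of_ge hx) (tlog_of_ge le_rfl)
    simpa using hl.union hr
  · have hev : tlog =ᶠ[𝓝 s] fun x ↦ x / log x :=
      (eventually_gt_nhds hs).mono fun x hx ↦ tlog_of_ge hx.le
    rw [hev.hasDerivAt_iff]
    simp only [tlog', not_le.2 hs, if_false]
    exact hasDerivAt_div_log (by have := add_one_le_exp (2:ℝ); linarith)

/-- `deriv tlog = tlog'`. [folklore] -/
theorem deriv_tlog : deriv tlog = tlog' := funext fun s ↦ (hasDerivAt_tlog s).deriv

/-- `tlog` is differentiable. [folklore] -/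
theorem differentiable_tlog : Differentiable ℝ tlog := fun s ↦ (hasDerivAt_tlog s).differentiableAt

/-- `tlog'` is non-increasing (`(L-1)/L²` decreases for `L ≥ 2` and equals `¼` at `L = 2`), i.e.
`tlog'' ≤ 0` (Hamilton 1997, p. 14: "`y'' = -K(ln x - 2)/(x ln³ x) ≤ 0` for `x ≥ e²`").
[cite: Hamilton1997, §2.2, Thm. 2.1 (proof, p. 14)] -/
theorem tlog'_antitone : Antitone tlog' := by
  intro s s' hss'
  by_cases h2 : s' ≤ exp 2
  · have h1 : s ≤ exp 2 := hss'.trans h2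
    simp [tlog', h1, h2]
  by_cases h1 : s ≤ exp 2
  · -- `s ≤ e² < s'`: `(L' - 1)/L'² ≤ 1/4`
    simp only [tlog', h1, h2, if_true, if_false]
    have hL := two_lt_log (not_le.1 h2)
    rw [div_le_div_iff₀ (by positivity) (by norm_num)]
    nlinarith [sq_nonneg (log s' - 2)]
  · simp only [tlog', h1, h2, if_false]
    have hL := two_lt_log (not_le.1 h1)
    have hL' := two_lt_log (not_le.1 h2)
    have hLL' : log s ≤ log s' :=
      log_le_log ((exp_pos 2).trans (not_le.1 h1)) hss'
    rw [div_le_div_iff₀ (by positivity) (by positivity)]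
    have key : (log s - 1) * log s' ^ 2 - (log s' - 1) * log s ^ 2 =
        (log s' - log s) * ((log s - 1) * (log s' - 1) - 1) := by ring
    have h3 : (0:ℝ) ≤ (log s - 1) * (log s' - 1) - 1 := by nlinarith
    nlinarith [key, mul_nonneg (sub_nonneg.2 hLL') h3]

/-- `tlog' ≥ 0` (Hamilton 1997, p. 14: "`y` is increasing"). [cite: Hamilton1997, §2.2, Thm. 2.1 (proof, p. 14)] -/
theorem tlog'_nonneg (s : ℝ) : 0 ≤ tlog' s := by
  unfold tlog'
  split_ifs with h
  · norm_num
  · have hL := two_lt_log (not_le.1 h)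
    exact div_nonneg (by linarith) (sq_nonneg _)

/-- `tlog` is concave on `ℝ`. [cite: Hamilton1997, §2.2, Thm. 2.1 (proof, p. 14)] -/
theorem concaveOn_tlog : ConcaveOn ℝ univ tlog :=
  Antitone.concaveOn_univ_of_deriv differentiable_tlog (by rw [deriv_tlog]; exact tlog'_antitone)

/-- `tlog` is non-decreasing. [folklore] -/
theorem monotone_tlog : Monotone tlog :=
  monotone_of_deriv_nonneg differentiable_tlog fun s ↦ by rw [deriv_tlog]; exact tlog'_nonneg s

/-- `u / max{ln u, Q} = min (u/Q) (tlog u)` for `u ≥ 0`, `Q ≥ 2`. [folklore] -/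
theorem div_max_log_eq_min {Q s : ℝ} (hQ : 2 ≤ Q) (hs : 0 ≤ s) :
    s / max (log s) Q = min (s / Q) (tlog s) := by
  have hQ0 : 0 < Q := by linarith
  rcases le_or_gt Q (log s) with hlog | hlog
  · -- `log s ≥ Q ≥ 2`: both sides are `s / log s`
    have hs2 : exp 2 ≤ s := by
      have : (2:ℝ) ≤ log s := hQ.trans hlog
      rcases hs.eq_or_lt with rfl | hs0
      · simp at this; linarith
      · rwa [le_log_iff_exp_le hs0] at this
    rw [max_eq_left hlog, tlog_of_ge hs2, min_eq_right]
    exact div_le_div_of_nonneg_left hs hQ0 hlog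
  · rw [max_eq_right hlog.le, min_eq_left]
    unfold tlog
    split_ifs with h
    · -- `s/Q ≤ s/2 ≤ s/4 + e²/4` using `s ≤ e²`
      have : s / Q ≤ s / 2 := div_le_div_of_nonneg_left hs two_pos hQ
      linarith
    · have hL := two_lt_log (not_le.1 h)
      exact div_le_div_of_nonneg_left hs (by linarith) hlog.le

/-- `u ↦ u / max{ln u, Q}` is concave on `[0, ∞)` for `Q ≥ 2` (minimum of a linear function and
the concave `tlog`). [cite: Hamilton1997, §2.2, Thm. 2.3 (proof, p. 17)] -/
theorem concaveOn_div_max_log {Q : ℝ} (hQ : 2 ≤ Q) :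
    ConcaveOn ℝ (Ici 0) fun s ↦ s / max (log s) Q := by
  have h1 : ConcaveOn ℝ (Ici (0:ℝ)) fun s : ℝ ↦ s / Q :=
    ⟨convex_Ici 0, fun x _ y _ a b _ _ _ ↦ le_of_eq (by simp only [smul_eq_mul]; ring)⟩
  have h2 : ConcaveOn ℝ (Ici (0:ℝ)) tlog := concaveOn_tlog.subset (subset_univ _) (convex_Ici 0)
  have h3 := h1.inf h2
  refine ⟨convex_Ici 0, fun x hx y hy a b ha hb hab ↦ ?_⟩
  have hxy : 0 ≤ a • x + b • y := by
    simp only [smul_eq_mul]; exact add_nonneg (mul_nonneg ha hx) (mul_nonneg hb hy)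
  have key := h3.2 hx hy ha hb hab
  simp only [Pi.inf_apply, smul_eq_mul] at key hxy ⊢
  rw [div_max_log_eq_min hQ hx, div_max_log_eq_min hQ hy, div_max_log_eq_min hQ hxy]
  exact key

/-- `u ↦ u / max{ln u, Q}` is non-decreasing on `[0, ∞)` for `Q ≥ 2`. [folklore] -/
theorem monotoneOn_div_max_log {Q : ℝ} (hQ : 2 ≤ Q) :
    MonotoneOn (fun s ↦ s / max (log s) Q) (Ici 0) := by
  intro s hs s' hs' hss'
  simp only
  rw [div_max_log_eq_min hQ hs, div_max_log_eq_min hQ hs']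
  exact min_le_min (div_le_div_of_nonneg_right hss' (by linarith)) (monotone_tlog hss')

/-- **Hamilton's right-hand side `F(u) = (1 + K/max{ln u, Q}) u` is concave on `[0, ∞)`** for
`K ≥ 0`, `Q ≥ 2` (Hamilton 1997, p. 14 for `Q = 2`, p. 17: "for the same reason as before if
`Q ≥ 2`"). [cite: Hamilton1997, §2.2, Thm. 2.1 (proof, pp. 13–14) and Thm. 2.3 (proof, p. 17)] -/
theorem concaveOn_logBarrier {K Q : ℝ} (hK : 0 ≤ K) (hQ : 2 ≤ Q) :
    ConcaveOn ℝ (Ici 0) fun u ↦ (1 + K / max (log u) Q) * u := by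
  have h := (concaveOn_id (convex_Ici (0:ℝ))).add ((concaveOn_div_max_log hQ).smul hK)
  refine ⟨convex_Ici 0, fun x hx y hy a b ha hb hab ↦ ?_⟩
  have key := h.2 hx hy ha hb hab
  simp only [Pi.add_apply, _root_.id, smul_eq_mul] at key ⊢
  have e : ∀ u : ℝ, (1 + K / max (log u) Q) * u = u + K * (u / max (log u) Q) := fun u ↦ by ring
  rw [e, e, e]
  exact key

/-- … and non-decreasing there (Hamilton 1997, p. 14: "`y` is increasing").
[cite: Hamilton1997, §2.2, Thm. 2.1 (proof, p. 14)] -/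
theorem monotoneOn_logBarrier {K Q : ℝ} (hK : 0 ≤ K) (hQ : 2 ≤ Q) :
    MonotoneOn (fun u ↦ (1 + K / max (log u) Q) * u) (Ici 0) := by
  intro s hs s' hs' hss'
  have e : ∀ u : ℝ, (1 + K / max (log u) Q) * u = u + K * (u / max (log u) Q) := fun u ↦ by ring
  simp only [e]
  have := monotoneOn_div_max_log hQ hs hs' hss'
  simp only at this
  nlinarith

/-- **Chord inequality for the sets of Thms. 2.1 / 2.3**: if `yᵢ ≤ F(√(xᵢzᵢ))` with
`xᵢ, zᵢ ≥ 0`, then `ay₁ + by₂ ≤ F(√((ax₁+bx₂)(az₁+bz₂)))` for `a, b ≥ 0`, `a + b = 1` (`F`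
concave and non-decreasing, the geometric mean concave: "a concave increasing function of a
concave function is concave", Hamilton 1997, p. 14). [cite: Hamilton1997, §2.2, Thm. 2.1 (proof, p. 14)] -/
theorem logBarrier_combo_le {K Q a b y₁ y₂ x₁ x₂ z₁ z₂ : ℝ} (hK : 0 ≤ K) (hQ : 2 ≤ Q)
    (ha : 0 ≤ a) (hb : 0 ≤ b) (hab : a + b = 1)
    (hx₁ : 0 ≤ x₁) (hx₂ : 0 ≤ x₂) (hz₁ : 0 ≤ z₁) (hz₂ : 0 ≤ z₂)
    (h₁ : y₁ ≤ (1 + K / max (log (sqrt (x₁ * z₁))) Q) * sqrt (x₁ * z₁))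
    (h₂ : y₂ ≤ (1 + K / max (log (sqrt (x₂ * z₂))) Q) * sqrt (x₂ * z₂)) :
    a * y₁ + b * y₂ ≤
      (1 + K / max (log (sqrt ((a * x₁ + b * x₂) * (a * z₁ + b * z₂)))) Q) *
        sqrt ((a * x₁ + b * x₂) * (a * z₁ + b * z₂)) := by
  set F : ℝ → ℝ := fun u ↦ (1 + K / max (log u) Q) * u with hF
  have hs₁ : 0 ≤ sqrt (x₁ * z₁) := sqrt_nonneg _
  have hs₂ : 0 ≤ sqrt (x₂ * z₂) := sqrt_nonneg _
  have hconc := (concaveOn_logBarrier hK hQ).2 (mem_Ici.2 hs₁) (mem_Ici.2 hs₂) ha hb hab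
  simp only [smul_eq_mul] at hconc
  have hcombo : 0 ≤ a * sqrt (x₁ * z₁) + b * sqrt (x₂ * z₂) := by positivity
  have hmono := monotoneOn_logBarrier hK hQ (mem_Ici.2 hcombo) (mem_Ici.2 (sqrt_nonneg _))
    (geomMean_combo_le_sqrt ha hb hx₁ hx₂ hz₁ hz₂)
  change a * y₁ + b * y₂ ≤ F _
  calc a * y₁ + b * y₂ ≤ a * F (sqrt (x₁ * z₁)) + b * F (sqrt (x₂ * z₂)) := by
        simp only [hF]; gcongr
    _ ≤ F (a * sqrt (x₁ * z₁) + b * sqrt (x₂ * z₂)) := hconc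
    _ ≤ F (sqrt ((a * x₁ + b * x₂) * (a * z₁ + b * z₂))) := hmono


end HamiltonODE

end Literature.Geometry.Riemannian

end
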